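import Literature.NumberTheory.EllipticCurves.SingularCubic
import Literature.NumberTheory.EllipticCurves.VariableChangePointsMap
import Mathlib.FieldTheory.IsAlgClosed.Basic
import HarnessLib

/-!
# Lang's theorem for a cuspidal Weierstrass cubic: `Q ↦ Frob(Q) − Q` is onto `Ẽ_ns(k̄)`
# (cell `b2b-bsdres`, team n1011, seat p10 GEN 8; THEOREM A programme, FILE 7a; plan
# `HOME/b2b-bsdres-n1011-p10/g8/THEOREM-A-PLAN.md`, note `g8/L41-NOTE.md`)

HONEST FRAMING (cell `b2b-bsdres`, run/shared/lean/b2b/bsd-rank1-residual/, verbatim in every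
file): the goal of the cell is to DELETE the COMBINATION-SHAPED residual classes of the
Birch–Swinnerton-Dyer formula for ALL analytic-rank `≤ 1` elliptic curves over `ℚ` — "full BSD
formula for every rank `≤ 1` curve in class `C`" assembled STRICTLY from published theorems — so
that the rank-`≤ 1` remainder becomes exactly the CONSTRUCTION-SHAPED classes, which are TYPED
(missing-input `Prop`s), NOT attempted. This is not "finishing BSD". Team n1011 (N10 / N11):
research route on the CONSTRUCTION-SHAPED class X4 (§I N11 LOWER half); no claim beyond the stated
classes; nothing is booked; marks UNCHANGED. Theorems only: no definition, no named fact, no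
`sorry`. TOOL theorems; they close nothing by themselves.

## What

The first brick of THEOREM A (the unramified class `χ_nr ∪ T` is a local Kummer class when the
`p`-torsion point `T` lies in the identity component `E₀(K_v)`): **Lang's theorem for the group of
nonsingular points of a CUSPIDAL cubic over a finite field.** For the singular model
`singularModel x₀ y₀ α α` over a finite field `k` (cusp at `(x₀, y₀)` with tangent slope `α`, all
in `k`), an algebraically closed `k`-algebra `k₀` and the `q`-power map `Fq ∈ Aut(k₀/k)`
(`q = #k`), every point `P ∈ Ẽ_ns(k₀)` is `Fq(Q) − Q` for some `Q` (`exists_map_frob_sub_eq_of_cusp`).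
This is the cuspidal companion of the tree's `WeierstrassCurve.exists_map_frob_sub_eq` (elliptic
reduction, via the isogeny `1 − Frob`). Proof: the tree's `singularModel.cuspEquiv : Ẽ_ns(k₀) ≃+ k₀`
(Silverman, *AEC*, III.2.5(b): `(x, y) ↦ (x − x₀)/(y − y₀ − α(x − x₀))`) intertwines `Fq` on points
with `c ↦ c^q` on `k₀` because `x₀, y₀, α ∈ k` (`cusp_coordinate_map_frob`), and `c ↦ c^q − c`
is onto `k₀` (Artin–Schreier: `X^q − X − t` has a root in the algebraically closed `k₀`).
`baseChange_singularModel` records `(singularModel x₀ y₀ α₁ α₂) ⊗_k k₀ = singularModel` of the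
images.

References: [SilvermanAEC2009] Prop. III.2.5(b); Lang, *Algebraic groups over finite fields*,
Amer. J. Math. 78 (1956) (the statement for connected groups; here the explicit `𝔾_a` case).
-/

noncomputable section

universe u

namespace Summit.BirchSwinnertonDyer.Rank1Residual.GaloisImage.TwistedWitness

open WeierstrassCurve Polynomial

variable {k : Type u} [Field k] {k₀ : Type u} [Field k₀] [Algebra k k₀]

/-- Base change of the singular model is the singular model of the images of `x₀, y₀, α₁, α₂`.
[folklore] -/
theorem baseChange_singularModel (x₀ y₀ α₁ α₂ : k) :
    (singularModel x₀ y₀ α₁ α₂).baseChange k₀ =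
      singularModel (algebraMap k k₀ x₀) (algebraMap k k₀ y₀) (algebraMap k k₀ α₁)
        (algebraMap k k₀ α₂) := by
  ext
  · simp only [baseChange, map_a₁, singularModel.a₁_eq, map_neg, map_add]
  · simp only [baseChange, map_a₂, singularModel.a₂_eq, map_sub, map_neg, map_mul, map_ofNat]
  · simp only [baseChange, map_a₃, singularModel.a₃_eq, map_add, map_mul, map_neg, map_ofNat]
  · simp only [baseChange, map_a₄, singularModel.a₄_eq, map_add, map_mul, map_neg, map_ofNat,
      map_pow]
  · simp only [baseChange, map_a₆, singularModel.a₆_eq, map_sub, map_add, map_mul, map_neg,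
      map_pow]

variable [DecidableEq k₀]

/-- **The cusp coordinate intertwines Frobenius**: with `x₀, y₀, α ∈ k`, Silverman's additive
coordinate `u = (x − x₀)/(y − y₀ − α(x − x₀))` of `Fq(Q)` is `Fq(u(Q))` for every `k`-algebra
automorphism `Fq` of `k₀`. [folklore] -/
theorem cusp_coordinate_map_frob (x₀ y₀ α : k) (Fq : k₀ ≃ₐ[k] k₀)
    (Q : ((singularModel x₀ y₀ α α).baseChange k₀).toAffine.Point) :
    singularModel.cuspHom (algebraMap k k₀ x₀) (algebraMap k k₀ y₀) (algebraMap k k₀ α)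
        (Affine.Point.congrEquiv (baseChange_singularModel (k₀ := k₀) x₀ y₀ α α)
          (Affine.Point.map (Fq : k₀ →ₐ[k] k₀) Q)) =
      Fq (singularModel.cuspHom (algebraMap k k₀ x₀) (algebraMap k k₀ y₀) (algebraMap k k₀ α)
        (Affine.Point.congrEquiv (baseChange_singularModel (k₀ := k₀) x₀ y₀ α α) Q)) := by
  rcases Q with _ | ⟨x, y, h⟩
  · rw [← Affine.Point.zero_def, map_zero, map_zero, map_zero, map_zero]
  · rw [Affine.Point.map_some, Affine.Point.congrEquiv_some, Affine.Point.congrEquiv_some,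
      singularModel.cuspHom_apply, singularModel.cuspHom_apply]
    change (Fq x - algebraMap k k₀ x₀) /
        (Fq y - algebraMap k k₀ y₀ - algebraMap k k₀ α * (Fq x - algebraMap k k₀ x₀)) =
      Fq ((x - algebraMap k k₀ x₀) / (y - algebraMap k k₀ y₀ - algebraMap k k₀ α * (x - algebraMap k k₀ x₀)))
    simp only [map_div₀, map_sub, map_mul, AlgEquiv.commutes]

/-- **Lang's theorem for a cuspidal cubic over a finite field** (`𝔾_a` case, explicit): for the
singular model with a cusp, `x₀, y₀, α ∈ k`, `k` finite, `k₀ ⊇ k` algebraically closed and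
`Fq(c) = c^{#k}`, the map `Q ↦ Fq(Q) − Q` is onto `Ẽ_ns(k₀)`. Cuspidal companion of the tree's
`WeierstrassCurve.exists_map_frob_sub_eq`. [cite: SilvermanAEC2009, Prop. III.2.5(b)] -/
theorem exists_map_frob_sub_eq_of_cusp [Finite k] [IsAlgClosed k₀] (x₀ y₀ α : k)
    (Fq : k₀ ≃ₐ[k] k₀) (hFq : ∀ c, Fq c = c ^ Nat.card k)
    (P : ((singularModel x₀ y₀ α α).baseChange k₀).toAffine.Point) :
    ∃ Q : ((singularModel x₀ y₀ α α).baseChange k₀).toAffine.Point,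
      Affine.Point.map (Fq : k₀ →ₐ[k] k₀) Q - Q = P := by
  have hbc := baseChange_singularModel (k₀ := k₀) x₀ y₀ α α
  set u : ((singularModel x₀ y₀ α α).baseChange k₀).toAffine.Point →+ k₀ :=
    (singularModel.cuspHom (algebraMap k k₀ x₀) (algebraMap k k₀ y₀) (algebraMap k k₀ α)).comp
      (Affine.Point.congrEquiv hbc).toAddMonoidHom with hu
  have hu_apply : ∀ Q, u Q = singularModel.cuspHom (algebraMap k k₀ x₀) (algebraMap k k₀ y₀)
      (algebraMap k k₀ α) (Affine.Point.congrEquiv hbc Q) := fun _ ↦ rfl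
  have hu_inj : Function.Injective u :=
    singularModel.cuspHom_injective.comp (Affine.Point.congrEquiv hbc).injective
  have hu_surj : Function.Surjective u :=
    singularModel.cuspHom_surjective.comp (Affine.Point.congrEquiv hbc).surjective
  have hu_frob : ∀ Q, u (Affine.Point.map (Fq : k₀ →ₐ[k] k₀) Q) = Fq (u Q) := fun Q ↦ by
    rw [hu_apply, hu_apply]; exact cusp_coordinate_map_frob x₀ y₀ α Fq Q
  -- Artin–Schreier: `c^q − c = u(P)` is solvable in `k₀`
  have hq : 2 ≤ Nat.card k := by
    haveI := Fintype.ofFinite k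
    rw [Nat.card_eq_fintype_card]
    exact Fintype.one_lt_card
  obtain ⟨c, hc⟩ : ∃ c : k₀, c ^ Nat.card k - c = u P := by
    set f : k₀[X] := X ^ Nat.card k + (-X - C (u P)) with hf
    have hlt : (-X - C (u P) : k₀[X]).degree < (X ^ Nat.card k : k₀[X]).degree := by
      rw [degree_X_pow]
      refine (degree_sub_le _ _).trans_lt (max_lt ?_ ?_)
      · rw [degree_neg, degree_X]; exact_mod_cast hq
      · exact degree_C_le.trans_lt (by exact_mod_cast (show 0 < Nat.card k by omega))
    have hdeg : f.degree = Nat.card k := by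
      rw [hf, degree_add_eq_left_of_degree_lt hlt, degree_X_pow]
    have hdeg0 : f.degree ≠ 0 := by
      rw [hdeg]; exact_mod_cast (show Nat.card k ≠ 0 by omega)
    obtain ⟨c, hc⟩ := IsAlgClosed.exists_root f hdeg0
    refine ⟨c, ?_⟩
    rw [IsRoot.def, hf] at hc
    simp only [eval_add, eval_pow, eval_X, eval_neg, eval_sub, eval_C] at hc
    linear_combination hc
  obtain ⟨Q, hQ⟩ := hu_surj c
  refine ⟨Q, hu_inj ?_⟩
  rw [map_sub, hu_frob, hQ, hFq, hc]

end Summit.BirchSwinnertonDyer.Rank1Residual.GaloisImage.TwistedWitness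

end
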